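import Summits.AtomisticToContinuum.HydrodynamicLimit.Theses.AntiMazurCoboundaries
import Summits.AtomisticToContinuum.HydrodynamicLimit.Theorems.CellForecastPressureDecay.Negative.PerParticle
import Literature.MathematicalPhysics.StatisticalMechanics.SpecificRelativeEntropy
import Literature.Analysis.FluidPDE.InfiniteHardSphereDynamics
import Literature.Analysis.FunctionSpaces.PointConfigFactorialMeasure

/-!
# Line `entropy-ball-invariant-states` — crux `AntiMazurCoboundaries.CellForecastPressureDecay`
(stmt-AtomisticToContinuum-13915, the N-free core of route AntiMazurCoboundaries)

Skeleton (crux-plan, round 1) of crux idea card `entropy-ball-invariant-states` (ideator 1, gen 2;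
triage r1-1 / r1-2 / r1-3: pass, with sharpenings (v)/(b)/(a)–(c) acted on below).

THE LEVER (card). The crux's exponent `2c Σ_i Ξ_T(i)`, `Ξ_T(i) = T⁻¹∫₀ᵀ g(v^{fc}_i)` along the
`R`-local isolated-cluster FORECAST, is an additive, exactly `R`-local, bounded score of the
time-zero Gibbs field, so the pressure dualises EXACTLY against states (Donsker–Varadhan), and the
Krylov–Bogoliubov (Cesàro) average of a dual optimiser loses nothing by linearity (time-averaging
the STATE = time-averaging the OBSERVABLE) while it can only lose entropy. The core therefore lands
on ONE time-free inequality for space-time invariant near-Gibbs states of the infinite dilute gas: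
ONE-BODY ENTROPIC STIFFNESS `2ρ|⟨g, f₁^ν⟩| ≤ h(ν | P)` (`stub_oneBodyEntropicStiffness`, the card's
C⁺, the only open stub).

HOW THE SKELETON CUTS IT (planner; deviations from the card's decl sketch are forced by the triage
and recorded in the line card `Lines/entropy-ball-invariant-states.md`):

* TEMPEREDNESS IS NOT AN ENTROPY-BALL PROPERTY (card falsifier (ii); triage r1-1 (v), r1-3 (b)):
  finite specific entropy allows fast particles of intensity `≍ h/V²`, whose influx from far away is
  not summable, so Alexander's flow is undefined on entropy-ball states and no soft argument makes
  Krylov–Bogoliubov limits tempered (Jensen + invariance + entropy only ever return polynomial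
  velocity tails). Hence C⁺ is typed over a DYNAMICS-FREE invariance notion, `IsForecastStationary`:
  every `k`-body local observable evaluated on the range-`R` isolated-cluster forecasts of the tree
  (`localClusterState`, enumerations averaged through `PointConfig.factorialMeasure`) has, in the
  limit `R → ∞`, its static expectation, at every horizon — meaningful for every law, equal to
  flow-stationarity for tempered states of a local Alexander flow, exactly "invariance phrased
  through the isolated finite-cluster flows in the limit `R → ∞`" (triage r1-1 sharpen). No
  `∀ Φ : InfiniteHardSphereFlow` and no named Alexander fact appears anywhere (triage note 3).
* KRYLOV–BOGOLIUBOV RUNS IN FINITE VOLUME, where it is exact convex analysis: on the unit torus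
  (`n` spheres of diameter `σ/Λ`, canonical law `torusGibbs`, flow-invariant)
  `∫⁻ e^{τ⁻¹∫₀^τ f∘Φ_t} dG ≤ exp(E_μ f − KL(μ|G))` for a `(2s/τ)`-almost invariant `μ ≪ G` with
  `KL(μ|G) ≤ 2‖f‖∞` (`stub_entropyBallDuality`, provable now). The GLOBAL finite-volume entropy
  inequality plus Jensen-in-time under the invariant `G` transfer EQUILIBRIUM large-deviation
  locality (`stub_influenceLocality` = route crux InfluenceLocality 13916 in cell scaling) to `μ`
  uniformly in `T` — this is what makes local limits forecast-stationary with no temperedness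
  (`stub_kbClosure`: local limits, lower semicontinuity of specific relative entropy + equivalence
  of ensembles, continuity of the one-body bias; Stiffness then bounds the torus dual value).
* NO INFINITE-VOLUME LDP (Georgii 1994 canonical / hard core / marks — card falsifier (i)) is used:
  only the exact finite-volume duality and the EASY (lower-semicontinuity) half along local limits.
* `stub_torusReduction`: cell (free b.c., Euclidean forecasts) → torus of side `Λ ∈ [L, 2L]`
  (periodic, true dynamics): embed the cube in the torus of side `L + σ` (the cell law IS the torus
  law conditioned on "all particles in the cube", an event of probability `≥ e^{−O(L²)}`), boundary
  layer `O(RL²/σ³)`, forecast → true by Hölder and `stub_influenceLocality`; the Hölder tilt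
  inflation `c ↦ c'`, `|c'| ≤ (1+ε)|c|`, is why `stub_kbClosure` is stated for `|c'| ≤ 2` with the
  bound `|c'|·KL + ηΛ³` (the composition takes `ε = min(η/(16κ), 1)`).
* `stub_diniTransfer : TorusInfluenceLocality → (PointwiseCore → UniformCore)` (`UniformCore` =
  the crux body verbatim) is the sibling crux card `dini-window-monotonicity` (window subadditivity
  + forecast-local add-one Lipschitz + Dini on `[0,2] × [−1,1]`); `PointwiseCore`,
  `cellWindowPressure` are that card's decls.

Composition (sorry-free, this file): `pointwiseCore_of_parts : CellToTorusReduction →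
EntropyBallDuality → KrylovBogoliubovClosure → PointwiseCore` (choices `η = δ/17`, `C₀ = 16κ`,
`T = T₀(C₀, η)`, `ε = min(η/(16κ), 1)`, `σ₀ = min`, `κ` from the closure, `L₀ = max`), and
`CellForecastPressureDecay_of : CellForecastPressureDecay` BY NAME from the six registered stubs
`stub_influenceLocality`, `stub_torusReduction`, `stub_entropyBallDuality`,
`stub_oneBodyEntropicStiffness`, `stub_kbClosure`, `stub_diniTransfer`.

Disproof used (`Cruxes/CellForecastPressureDecay/Disproof.lean`, cycle 1; landed Negative lemmas
imported above via `…Negative.PerParticle` ⊇ `LoneParticle` ⊇ `WithoutOrthogonality`, p74445 /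
p73994 / p73681): `_false_without_orthogonality` (§2) is honoured at `stub_oneBodyEntropicStiffness`
— for `ν = P` itself `h = 0` while `2|bias| = 2ρ|E_M g|`, so `g ⊥ 1` is used exactly there — AND at
`stub_kbClosure` (for `μ = G` the conclusion reads `2c' n E_M g ≤ ηΛ³`); `g ⊥ v, |v|²` with `∃κ`
prices the thermal / drifted Gibbs states and the energy-shell conditionings (§7 near-miss: stiff
iff `κ < κ*`; both S1 and S3 carry `∃κ`); `_false_perParticle` (§6) — every statement is per VOLUME
(`e^{δL³}`, `ηΛ³`, specific entropy, the intensity factor `ρ` inside `oneBodyBias`), and the slack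
`ηΛ³` is what makes `stub_kbClosure` true for `n = O(1)` (a lone particle keeps ANY velocity law,
§3–4); §1 (`isProbabilityMeasure_cellLaw`) is the cell frame. No stub is an instance of a landed
Negative lemma, and none integrates flow junk off good sets (all integrals are against
`torusGibbs`-absolutely-continuous laws or the crux's own cell law; the refutation pattern of
`BGEndpointRigidityLanfordEnvelope_refuted` does not apply).
-/

noncomputable section

open MeasureTheory ProbabilityTheory Set Filter Topology
open scoped ENNReal Classical

namespace Summit.AtomisticToContinuum.HydrodynamicLimit.Cruxes.CellForecastPressureDecay.EntropyBallInvariantStates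

open Literature.MathematicalPhysics.KineticTheory (T3 V3)
open Literature.Analysis.FunctionSpaces (PointConfig)
open Literature.Analysis.FluidPDE (HardSphereFlow Config localClusterState canonicalDensity particleLaw
  globalMaxwellian IsHardSphereGibbs IsTranslationInvariant IsHardCore)
open Literature.MathematicalPhysics.StatisticalMechanics (specificRelativeEntropy HasFiniteSpecificEntropy
  unitCube)
open Summit.AtomisticToContinuum.HydrodynamicLimit.Theses.AntiMazurCoboundaries (CellForecastPressureDecay)

/-! ## 1. Frames

Cell frame (the crux's): cube `[0,L]³ ⊂ ℝ³`, `n` spheres of diameter `σ`, standard Maxwellian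
velocities, horizon `T`, forecasts of range `R` from isolated Euclidean cluster flows `Ψ k`.
Torus frame: the unit torus `𝕋³`, the same `n` spheres with diameter `σ/L`, the same velocities;
torus length = cell length `/L`, torus time = cell time `/L`. Infinite-volume frame = cell frame
(`PointConfig (ℝ³ × ℝ³)`, hard core `σ`, intensity `≤ 2`, `θ = 1`, `u₀ = 0`). -/

/-- Families of isolated Euclidean hard-sphere cluster flows of diameter `σ` (the crux's `Ψ`). -/
abbrev ClusterFlows (σ : ℝ) : Type :=
  (k : ℕ) → HardSphereFlow (Literature.Analysis.FluidPDE.Euclidean.geometry (Fin 3)) σ k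

/-- Hard-sphere flows of `n` spheres of diameter `ε` on the unit torus `𝕋³`. -/
abbrev TorusFlow (ε : ℝ) (n : ℕ) : Type :=
  HardSphereFlow (Literature.Analysis.FluidPDE.Torus.geometry (Fin 3)) ε n

/-- Families of isolated torus cluster flows of diameter `ε` (forecasts on the torus). -/
abbrev TorusClusterFlows (ε : ℝ) : Type :=
  (k : ℕ) → HardSphereFlow (Literature.Analysis.FluidPDE.Torus.geometry (Fin 3)) ε k

/-- Phase space of `n` labelled spheres on `𝕋³`. -/
abbrev TorusPhase (n : ℕ) : Type := Config n (Fin 3) T3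

/-- The crux's canonical cell Gibbs law `P_{n,L}`: `n` spheres of diameter `σ`, positions uniform
on the hard-core configurations in `[0,L]³`, standard Maxwellian velocities (the crux's measure,
verbatim). A probability measure for `σ ≤ 3/16`, `L ≥ 1`, `n ≤ 2L³`
(`…Theorems.CellForecastPressureDecay.isProbabilityMeasure_cellLaw`, landed). -/
def cellLaw (σ L : ℝ) (n : ℕ) (Ψ : ClusterFlows σ) : Measure (Config n (Fin 3) V3) :=
  particleLaw (Ψ n) (canonicalDensity (Literature.Analysis.FluidPDE.Euclidean.geometry (Fin 3)) σ n
    (fun p => Set.indicator {x : V3 | ∀ k, x k ∈ Set.Icc (0 : ℝ) L} (fun _ => (1 : ℝ)) p.1 *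
      globalMaxwellian p.2))

/-- The crux's cell functional (sibling card `dini-window-monotonicity`, decl `cellWindowPressure`,
verbatim up to the name of the law): `∫⁻ exp(2c Σ_{i<n} T⁻¹∫₀ᵀ g(v^{fc}_i(t)) dt) dP_{n,L}`. -/
def cellWindowPressure (σ : ℝ) (g : V3 → ℝ) (c T R L : ℝ) (n : ℕ) (Ψ : ClusterFlows σ) : ℝ≥0∞ :=
  ∫⁻ z, ENNReal.ofReal (Real.exp (2 * c * ∑ i : Fin n, T⁻¹ * ∫ t in (0 : ℝ)..T,
      g (localClusterState Ψ R t z i).2)) ∂(cellLaw σ L n Ψ)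

/-- The torus canonical Gibbs law: `n` spheres of diameter `ε` on `𝕋³`, positions uniform on the
hard-core configurations, standard Maxwellian velocities; invariant under every torus hard-sphere
flow (Liouville preservation + energy conservation — proved by the stubs that use it). -/
def torusGibbs (ε : ℝ) (n : ℕ) (Φ : TorusFlow ε n) : Measure (TorusPhase n) :=
  particleLaw Φ (canonicalDensity (Literature.Analysis.FluidPDE.Torus.geometry (Fin 3)) ε n
    (fun p => globalMaxwellian p.2))

/-- The torus twin of the crux's score along the TRUE dynamics: `f(z) = 2c' Σ_i g(v_i)`. -/
def fluxSum (g : V3 → ℝ) (c' : ℝ) (n : ℕ) (z : TorusPhase n) : ℝ :=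
  2 * c' * ∑ i : Fin n, g ((z i).2)

/-- Exponential moment, under the torus Gibbs law, of the window-`τ` time average of `f` along the
torus flow: `∫⁻ exp(τ⁻¹ ∫₀^τ f(Φ_t z) dt) dG` (torus time units). -/
def torusExpMoment (ε : ℝ) (n : ℕ) (Φ : TorusFlow ε n) (f : TorusPhase n → ℝ) (τ : ℝ) : ℝ≥0∞ :=
  ∫⁻ z, ENNReal.ofReal (Real.exp (τ⁻¹ * ∫ t in (0 : ℝ)..τ, f (Φ.flow t z))) ∂(torusGibbs ε n Φ)

/-! ## 2. Infinite-volume objects: one-body bias, forecast functionals, forecast-stationarity -/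

/-- ONE-BODY BIAS of a law `ν` on marked configurations of `ℝ³ × ℝ³` in the fast direction `g`:
`E_ν[Σ_{(q,v) ∈ ω, q ∈ [0,1)³} g(v)] = ρ_ν ⟨g, f₁^ν⟩` — written junk-free as the integral of
`1_{[0,1)³}(q) g(v)` against the first factorial moment (intensity) measure of `ν`
(`PointConfig.corrMeasure ν 1`, Campbell's formula `lintegral_corrMeasure`; finite intensity makes
the integrand integrable). The card's `oneBodyBias` (a Bochner integral of `windowSumReal`) is the
same number for the laws quantified below. -/
def oneBodyBias (g : V3 → ℝ) (ν : Measure (PointConfig (V3 × V3))) : ℝ :=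
  ∫ p, (unitCube : Set V3).indicator (fun _ => (1 : ℝ)) (p 0).1 * g (p 0).2 ∂(PointConfig.corrMeasure ν 1)

/-- The phase-space window above the closed ball of radius `r` about the origin. -/
def ballWindow (r : ℝ) : Set (V3 × V3) := Metric.closedBall (0 : V3) r ×ˢ Set.univ

/-- `k`-BODY FORECAST FUNCTIONAL (dynamics-free: only FINITE isolated cluster flows `Ψ k` enter).
Enumerate the particles of `ω` with position in `B̄(0, r + 2R)` (averaging over the `m!`
enumerations `z`, i.e. integrating against `PointConfig.factorialMeasure` and dividing by `m!`),
let every particle with initial position in `B̄(0, r + R)` be FORECAST by the isolated Euclidean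
dynamics of its range-`R` cluster (tree `localClusterState`; that cluster lies inside the enumerated
window), and sum the test function `φ` over ordered `k`-tuples of distinct such particles evaluated
at their forecast states at time `s`. Junk-free: if the window holds infinitely many particles every
summand is `0`. Test functions `φ ≥ 0` are meant to vanish unless all `k` positions lie in
`B̄(0,r)` (imposed where used), so that in the limit `R → ∞` nothing is missed but "jumpers". -/
def forecastFunctional {σ : ℝ} (Ψ : ClusterFlows σ) (r R s : ℝ) (k : ℕ)
    (φ : (Fin k → V3 × V3) → ℝ≥0∞) (ω : PointConfig (V3 × V3)) : ℝ≥0∞ :=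
  ∑' m : ℕ, if ω.count (ballWindow (r + 2 * R)) = (m : ℕ∞) then
    ((Nat.factorial m : ℝ≥0∞))⁻¹ *
      ∫⁻ z, (∑ j : Fin k ↪ Fin m,
          (∏ a : Fin k, (Metric.closedBall (0 : V3) (r + R)).indicator (fun _ => (1 : ℝ≥0∞)) (z (j a)).1) *
            φ (fun a => localClusterState Ψ R s z (j a)))
        ∂(PointConfig.factorialMeasure m (ω.restrict (ballWindow (r + 2 * R))))
    else 0

/-- The STATIC `k`-body window functional `Σ^{≠}_{p₁,…,p_k ∈ ω, positions in B̄(0,r)} φ(p₁,…,p_k)`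
(integration against the `k`-th factorial measure of the restricted configuration; its
`ν`-expectation is the `k`-th factorial moment measure of `ν` tested against `φ`). -/
def staticFunctional (r : ℝ) (k : ℕ) (φ : (Fin k → V3 × V3) → ℝ≥0∞) (ω : PointConfig (V3 × V3)) :
    ℝ≥0∞ :=
  ∫⁻ p, φ p ∂(PointConfig.factorialMeasure k (ω.restrict (ballWindow r)))

/-- FORECAST-STATIONARITY of a law `ν` on marked configurations (the dynamics-free invariance notion
of this line): for every family of isolated Euclidean cluster flows, every radius `r`, horizon
`s ≥ 0`, order `k` and every bounded measurable `k`-body test function supported over `B̄(0,r)^k`,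
the expectation of the range-`R` forecast functional converges, as `R → ∞`, to the static
expectation — ALL correlation functions are stationary under the cluster dynamics in the limit of
infinite range. For a tempered state carried by a LOCAL Alexander flow (eventual agreement with
finite truncations, the locality clause of `RelEntropyErgodic.GibbsErgodicity`) this is exactly
flow-stationarity; it needs no infinite-volume flow, is what Krylov–Bogoliubov provably delivers
(`stub_kbClosure`), and is what the stationary BBGKY balance identities consume. -/
def IsForecastStationary (σ : ℝ) (ν : Measure (PointConfig (V3 × V3))) : Prop :=
  ∀ Ψ : ClusterFlows σ, ∀ r s : ℝ, 0 < r → 0 ≤ s → ∀ k : ℕ,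
    ∀ φ : (Fin k → V3 × V3) → ℝ≥0∞, Measurable φ → (∀ p, φ p ≤ 1) →
      (∀ p, (∃ a, (p a).1 ∉ Metric.closedBall (0 : V3) r) → φ p = 0) →
        Tendsto (fun R : ℕ => ∫⁻ ω, forecastFunctional Ψ r R s k φ ω ∂ν) atTop
          (𝓝 (∫⁻ ω, staticFunctional r k φ ω ∂ν))

/-! ## 3. Statements of the stubs -/

/-- Statement of `stub_oneBodyEntropicStiffness` — **ONE-BODY ENTROPIC STIFFNESS (the card's C⁺, the
bet; OPEN, hardest).** For `σ < σ₀` there is an amplitude `κ > 0` such that for every admissible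
fast observable `g` (continuous, `|g| ≤ κ`, `g ⊥ span(1, v, |v|²)` in `L²(stdGaussian)`), every
translation-invariant hard-sphere Gibbs state `P` of diameter `σ` (activity `z`, `β = 1`, no drift)
of intensity `≤ 2`, and every law `ν` that is a translation-invariant probability on hard-core
configurations, of intensity `≤ 2`, finite kinetic-energy density, finite specific entropy relative
to `P` (Liverani–Olla form) and FORECAST-STATIONARY: `2 |ρ_ν ⟨g, f₁^ν⟩| ≤ h(ν | P)`.
In words: invariant states cannot realise the Pinsker-extremal trade-off (`bias ≍ √h`) in the fast
one-body directions; thermal / drifted Gibbs states (second-order gain `≤ Cκ s²` vs cost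
`ρ(3/2)(s − log(1+s))`) are stiff iff `κ < κ*` (the refuters' certified `∃κ` floor, Disproof §7);
`ν = P` forces `g ⊥ 1` (Disproof §2); density mixtures have zero bias; the `d = 1` / `σ = 0`
product states `⊗f(v)` ARE cheap and forecast-stationary — the statement is an interaction effect
of `d = 3` hard spheres, consistent with Disproof §3–6. Its hard slice is stationary molecular
chaos (contact pair correlations of invariant finite-entropy states); suggested tools on the line
card (BBGKY₁ balance + entropy pricing of the contact functional `∫B c₂ Δ(L⁻¹g)` with `L⁻¹g` from
the PROVED gap; Gurevich–Suhov for the Gibbsian optimisers). -/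
def OneBodyEntropicStiffness : Prop :=
  ∃ σ₀ : ℝ, 0 < σ₀ ∧ ∀ σ : ℝ, 0 < σ → σ < σ₀ → ∃ κ : ℝ, 0 < κ ∧
    ∀ g : V3 → ℝ, Continuous g → (∀ v, |g v| ≤ κ) →
      (∀ (c₀ c₂ : ℝ) (b : V3),
        ∫ v, g v * (c₀ + inner ℝ b v + c₂ * ‖v‖ ^ 2) ∂(ProbabilityTheory.stdGaussian V3) = 0) →
      ∀ (z : ℝ) (P : Measure (PointConfig (V3 × V3))), 0 < z → IsHardSphereGibbs σ z 1 0 P →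
        IsTranslationInvariant P → Literature.MathematicalPhysics.StatisticalMechanics.intensity P ≤ 2 →
        ∀ ν : Measure (PointConfig (V3 × V3)), IsProbabilityMeasure ν → IsTranslationInvariant ν →
          (∀ᵐ ω ∂ν, IsHardCore σ ω) →
          Literature.MathematicalPhysics.StatisticalMechanics.intensity ν ≤ 2 →
          Literature.Analysis.FluidPDE.kineticEnergyDensity ν < ⊤ →
          HasFiniteSpecificEntropy ν P → IsForecastStationary σ ν →
            2 * |oneBodyBias g ν| ≤ (specificRelativeEntropy ν P).toReal

/-- Statement of `stub_influenceLocality` — **FINITE SPEED OF INFLUENCE IN EXPONENTIAL MOMENTS ON THE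
TORUS, at the horizon chosen BEFORE the range** (= route crux `InfluenceLocality`, stmt-13916, read in
the cell scaling and uniformly over densities `n/Λ³ ≤ 2`, i.e. reduced diameters `≤ 2^{1/3}σ`; triage
r1-1/2/3 certified that this quantifier order survives the sprinter / relay / avalanche counts that
kill linear cones). On `𝕋³` with `n ≤ 2Λ³` spheres of diameter `σ/Λ` under the canonical law
`torusGibbs`: for every horizon `s` (cell units; `s/Λ` torus), tilt `lam` and `δ > 0` there is `R₀`
such that for `R ≥ R₀` and all large `Λ`, uniformly in `n`, the torus flow and the torus cluster
flows, `∫⁻ exp(lam · #{i : ∃ t ≤ s/Λ, Φ_t z i ≠ its (R/Λ)-local torus forecast}) dG ≤ e^{δΛ³}`.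
Consumed three times: forecast → true dynamics in `stub_torusReduction`, forecast-stationarity of
local limits in `stub_kbClosure` (through the GLOBAL entropy inequality under the K–B averages), and
window monotonicity inside `stub_diniTransfer`. -/
def TorusInfluenceLocality : Prop :=
  ∃ σ₀ : ℝ, 0 < σ₀ ∧ ∀ σ : ℝ, 0 < σ → σ < σ₀ →
    ∀ (s lam δ : ℝ), 0 < s → 0 < lam → 0 < δ → ∃ R₀ : ℝ, 0 < R₀ ∧ ∀ R : ℝ, R₀ ≤ R →
      ∃ Λ₀ : ℝ, 0 < Λ₀ ∧ ∀ Λ : ℝ, Λ₀ ≤ Λ → ∀ n : ℕ, (n : ℝ) ≤ 2 * Λ ^ 3 →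
        ∀ (Φ : TorusFlow (σ / Λ) n) (Ψ : TorusClusterFlows (σ / Λ)),
          ∫⁻ z, ENNReal.ofReal (Real.exp (lam *
              ((Finset.univ.filter fun i : Fin n =>
                ∃ t ∈ Set.Icc (0 : ℝ) (s / Λ), Φ.flow t z i ≠ localClusterState Ψ (R / Λ) t z i).card : ℝ)))
            ∂(torusGibbs (σ / Λ) n Φ) ≤ ENNReal.ofReal (Real.exp (δ * Λ ^ 3))

/-- Statement of `stub_torusReduction` — **CELL → TORUS REDUCTION (free b.c. forecasts → periodic true
dynamics on a torus of comparable size, one Hölder tilt inflation).** For fixed `(σ, g, ρ, c, T)` and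
every `η, ε > 0` there is a range `R₀` such that for `R ≥ R₀` and all large `L`, for every family of
Euclidean cluster flows, the cell functional at `n = ⌊ρL³⌋₊` is bounded by `e^{ηL³}` times (`1 ⊔`)
the torus exponential moment of the window-`T/Λ` time average of `2c' Σ_i g(v_i)` along SOME flow of
the SAME `n` spheres on a torus of side `Λ ∈ [L, 2L]` (cell units; diameter `σ/Λ` on the unit torus;
all flows agree a.e.), for SOME `|c'| ≤ (1+ε)|c|`, the torus Gibbs law being a probability measure.
Proof plan: (i) EMBEDDING — put the cube `[0,L]³` inside the torus of side `Λ = L + σ`: every cell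
configuration is a torus hard-core configuration and the cell law IS the torus canonical law
conditioned on `A = {all particles in the cube}`, with `G(A) ≥ e^{−O(L²)}` (surface free energy,
`3nσ/L`); on `A` the Euclidean and torus `R`-local scores differ only for the `O(L²R/σ³)` particles
within `R` of the faces (packing) and for clusters hot enough to wrap (`E_cl ≳ Λ²/s²`, Maxwellian
tails) — total `e^{O(κL²R/σ³)} = e^{o(L³)}`; (ii) forecast → true dynamics on the torus by Hölder
`(1+ε, (1+ε)/ε)` and `TorusInfluenceLocality` with `lam = 4κ(1+ε)/ε`, horizon `T`; (iii)
`I^{1/(1+ε)} ≤ 1 ⊔ I`. No orthogonality of `g` is used. -/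
def CellToTorusReduction : Prop :=
  ∃ σ₀ : ℝ, 0 < σ₀ ∧ ∀ σ : ℝ, 0 < σ → σ < σ₀ → ∀ κ : ℝ, 0 < κ →
    ∀ g : V3 → ℝ, Continuous g → (∀ v, |g v| ≤ κ) →
    ∀ ρ : ℝ, 0 ≤ ρ → ρ ≤ 2 → ∀ c : ℝ, |c| ≤ 1 → ∀ T : ℝ, 0 < T → ∀ η : ℝ, 0 < η → ∀ ε : ℝ, 0 < ε →
      ∃ R₀ : ℝ, 0 < R₀ ∧ ∀ R : ℝ, R₀ ≤ R → ∃ L₀ : ℝ, 0 < L₀ ∧ ∀ L : ℝ, L₀ ≤ L →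
        ∀ Ψ : ClusterFlows σ, ∃ Λ : ℝ, L ≤ Λ ∧ Λ ≤ 2 * L ∧
          ∃ (Φ : TorusFlow (σ / Λ) ⌊ρ * L ^ 3⌋₊) (c' : ℝ),
            IsProbabilityMeasure (torusGibbs (σ / Λ) ⌊ρ * L ^ 3⌋₊ Φ) ∧ |c'| ≤ (1 + ε) * |c| ∧
            cellWindowPressure σ g c T R L ⌊ρ * L ^ 3⌋₊ Ψ ≤
              ENNReal.ofReal (Real.exp (η * L ^ 3)) *
                (1 ⊔ torusExpMoment (σ / Λ) ⌊ρ * L ^ 3⌋₊ Φ (fluxSum g c' ⌊ρ * L ^ 3⌋₊) (T / Λ))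

/-- Statement of `stub_entropyBallDuality` — **EXACT ENTROPY-BALL DUALITY WITH A KRYLOV–BOGOLIUBOV
WITNESS (finite volume; TRUE, provable now; the card's two levers in one line each).** On the torus,
whenever the canonical law `G = torusGibbs` is a probability measure, for every bounded measurable
`f` and window `τ > 0` there is a probability law `μ ≪ G` with `KL(μ | G) ≤ 2‖f‖∞`, which is
`(2s/τ)`-ALMOST INVARIANT (`|μ(Φ_s⁻¹B) − μ(B)| ≤ 2s/τ`), such that
`∫⁻ e^{τ⁻¹∫₀^τ f∘Φ_t} dG ≤ exp(E_μ f − KL(μ | G))`.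
Proof: `λ := e^{A}G/Z`, `A = τ⁻¹∫₀^τ f∘Φ_t` (a.e.-measurable on the conull good set,
`HardSphereFlow.aemeasurable_intervalIntegral_comp_flow_torus`); Donsker–Varadhan / Gibbs:
`log Z = E_λ A − KL(λ|G)`; `μ := τ⁻¹∫₀^τ λΦ_t⁻¹ dt` (K–B average): `E_μ f = E_λ A` (Fubini —
LINEARITY, lossless), `KL(μ|G) ≤ τ⁻¹∫ KL(λΦ_t⁻¹|G) = KL(λ|G)` (joint convexity of KL + invariance of
`G`: Liouville preservation `HardSphereFlow.measurePreserving` + energy conservation on good orbits),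
`KL(λ|G) = E_λA − log Z ≤ 2‖f‖∞`, and `μΦ_s⁻¹ − μ = τ⁻¹(∫_τ^{τ+s} − ∫_0^s) λΦ_t⁻¹ dt`. -/
def EntropyBallDuality : Prop :=
  ∀ (ε : ℝ) (n : ℕ) (Φ : TorusFlow ε n), 0 < ε →
    IsProbabilityMeasure (torusGibbs ε n Φ) →
    ∀ f : TorusPhase n → ℝ, Measurable f → ∀ C : ℝ, (∀ z, |f z| ≤ C) → ∀ τ : ℝ, 0 < τ →
      ∃ μ : Measure (TorusPhase n), IsProbabilityMeasure μ ∧ μ ≪ torusGibbs ε n Φ ∧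
        InformationTheory.klDiv μ (torusGibbs ε n Φ) ≤ ENNReal.ofReal (2 * C) ∧
        (∀ s : ℝ, 0 ≤ s → ∀ B : Set (TorusPhase n), MeasurableSet B →
          |(μ (Φ.flow s ⁻¹' B)).toReal - (μ B).toReal| ≤ 2 * s / τ) ∧
        torusExpMoment ε n Φ f τ ≤
          ENNReal.ofReal (Real.exp (∫ z, f z ∂μ - (InformationTheory.klDiv μ (torusGibbs ε n Φ)).toReal))

/-- Statement of `stub_kbClosure` — **KRYLOV–BOGOLIUBOV CLOSURE: almost-invariant torus states in the
entropy ball are stiff, up to `η` per volume, once the window is long (GIVEN Stiffness and influence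
locality; TRUE-grade, size L).** For `σ < σ₀`, an amplitude `κ`, admissible `g`, entropy budget `C₀`
and `η > 0` there is `T₀` such that for `T ≥ T₀` and all large `Λ`, for every particle number
`n ≤ 2Λ³` (diameter `σ/Λ` on the unit torus): every probability law `μ ≪ G` with `KL(μ|G) ≤ C₀Λ³`
and `|μ(Φ_s⁻¹B) − μ(B)| ≤ 2sΛ/T` (all torus times `s ≥ 0`, i.e. defect `2 s_cell/T`) satisfies
`E_μ[2c' Σ_i g(v_i)] ≤ |c'| KL(μ|G) + ηΛ³` for every `|c'| ≤ 2`.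
Proof plan (by contradiction along `T_k, Λ_k → ∞`, `n_k/Λ_k³ → ρ* ∈ [0,2]`, `c'_k → c*`; WLOG `μ_k`
translation-averaged, which lowers `KL` and keeps bias and defect): blow the torus up by `Λ_k`
around a uniform point (OVY `localLaw`); local limits `ν` exist (entropy budget ⇒ local compactness,
GZ 1993 Prop. 2.6 form; hard core; energy from the entropy inequality), are translation invariant,
of intensity `ρ*`, finite energy density, `HasFiniteSpecificEntropy ν P*` with
`h(ν|P*) ≤ liminf Λ⁻³ KL(μ_k|G_k)` (lower semicontinuity of specific entropy relative to the
Poisson–Maxwell reference + the thermodynamic identity `f(ρ*) = ρ* log z* − p(z*)` — equivalence of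
the canonical torus and grand-canonical ensembles at low density, Ruelle 1969 Thm 4.2.3 / §7.2,
Georgii 1995; `P*` the translation-invariant Gibbs state of intensity `ρ*`, cluster expansion;
`ρ* = 0` needs nothing: the left side tends to `0`), `ρ_ν⟨g,f₁^ν⟩ = lim Λ⁻³E_{μ_k}[Σ g(v_i)]`
(bounded local functional by hard-core packing), and FORECAST-STATIONARY: for fixed `(r, s, φ, R)`
the forecast functionals are bounded local functionals, so pass to the limit; under `μ_k` a bad
(forecast ≠ true) or jumping (displacement `> R`) particle spoils only summands ending within `r/Λ`
of the base point, so after the translation average the defect is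
`≤ C r³ · Λ⁻³E_{μ_k}[#bad + #jumpers] + M_r · 2s/T_k ≤ C r³ lam⁻¹(C₀ + 1) + o(1)` by the GLOBAL
entropy inequality `E_μ X ≤ lam⁻¹(KL(μ|G) + log E_G e^{lam X})`, `TorusInfluenceLocality` at
horizon `s`, tilt `lam`, range `R ≥ R₀(s, lam, 1)` (jumpers ⊆ bad ∪ hot clusters, Maxwellian tails),
uniformly in `k` — then `lam → ∞` with `R`. Stiffness at `P*` gives `2|bias(ν)| ≤ h(ν|P*)`,
contradicting `2c*·bias(ν) ≥ |c*|·liminf Λ⁻³KL + η` with `|c*| ≤ 2`. -/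
def KrylovBogoliubovClosure : Prop :=
  ∃ σ₀ : ℝ, 0 < σ₀ ∧ ∀ σ : ℝ, 0 < σ → σ < σ₀ → ∃ κ : ℝ, 0 < κ ∧
    ∀ g : V3 → ℝ, Continuous g → (∀ v, |g v| ≤ κ) →
      (∀ (c₀ c₂ : ℝ) (b : V3),
        ∫ v, g v * (c₀ + inner ℝ b v + c₂ * ‖v‖ ^ 2) ∂(ProbabilityTheory.stdGaussian V3) = 0) →
      ∀ C₀ : ℝ, 0 < C₀ → ∀ η : ℝ, 0 < η →
        ∃ T₀ : ℝ, 0 < T₀ ∧ ∀ T : ℝ, T₀ ≤ T → ∃ Λ₀ : ℝ, 0 < Λ₀ ∧ ∀ Λ : ℝ, Λ₀ ≤ Λ →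
          ∀ n : ℕ, (n : ℝ) ≤ 2 * Λ ^ 3 →
          ∀ (Φ : TorusFlow (σ / Λ) n) (μ : Measure (TorusPhase n)),
            IsProbabilityMeasure (torusGibbs (σ / Λ) n Φ) → IsProbabilityMeasure μ →
            μ ≪ torusGibbs (σ / Λ) n Φ →
            InformationTheory.klDiv μ (torusGibbs (σ / Λ) n Φ) ≤ ENNReal.ofReal (C₀ * Λ ^ 3) →
            (∀ s : ℝ, 0 ≤ s → ∀ B : Set (TorusPhase n), MeasurableSet B →
              |(μ (Φ.flow s ⁻¹' B)).toReal - (μ B).toReal| ≤ 2 * s * Λ / T) →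
            ∀ c' : ℝ, |c'| ≤ 2 →
              ∫ z, fluxSum g c' n z ∂μ ≤
                |c'| * (InformationTheory.klDiv μ (torusGibbs (σ / Λ) n Φ)).toReal + η * Λ ^ 3

/-- **POINTWISE CORE** (sibling card `dini-window-monotonicity`, decl `PointwiseCore`, verbatim): the
crux with the density `ρ ∈ [0,2]` and the tilt `|c| ≤ 1` fixed BEFORE `δ, T`, at `n = ⌊ρL³⌋₊`. -/
def PointwiseCore : Prop :=
  ∃ σ₀ : ℝ, 0 < σ₀ ∧ ∀ σ : ℝ, 0 < σ → σ < σ₀ → ∃ κ : ℝ, 0 < κ ∧ ∀ g : V3 → ℝ, Continuous g →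
    (∀ v, |g v| ≤ κ) →
    (∀ (c₀ c₂ : ℝ) (b : V3),
      ∫ v, g v * (c₀ + inner ℝ b v + c₂ * ‖v‖ ^ 2) ∂(ProbabilityTheory.stdGaussian V3) = 0) →
    ∀ ρ : ℝ, 0 ≤ ρ → ρ ≤ 2 → ∀ c : ℝ, |c| ≤ 1 → ∀ δ : ℝ, 0 < δ →
      ∃ T : ℝ, 0 < T ∧ ∃ R₀ : ℝ, 0 < R₀ ∧ ∀ R : ℝ, R₀ ≤ R → ∃ L₀ : ℝ, 0 < L₀ ∧ ∀ L : ℝ, L₀ ≤ L →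
        ∀ Ψ : ClusterFlows σ,
          cellWindowPressure σ g c T R L ⌊ρ * L ^ 3⌋₊ Ψ ≤ ENNReal.ofReal (Real.exp (δ * L ^ 3))

/-- **UNIFORM CORE** — the body of the crux `AntiMazurCoboundaries.CellForecastPressureDecay`,
verbatim (a local name so that only `CellForecastPressureDecay_of` concludes the route decl). -/
def UniformCore : Prop :=
  ∃ σ₀ : ℝ, 0 < σ₀ ∧ ∀ σ : ℝ, 0 < σ → σ < σ₀ → ∃ κ : ℝ, 0 < κ ∧ ∀ g : Literature.MathematicalPhysics.KineticTheory.V3 → ℝ, Continuous g → (∀ v, |g v| ≤ κ) → (∀ (c₀ c₂ : ℝ) (b : Literature.MathematicalPhysics.KineticTheory.V3), ∫ v, g v * (c₀ + inner ℝ b v + c₂ * ‖v‖ ^ 2) ∂(ProbabilityTheory.stdGaussian Literature.MathematicalPhysics.KineticTheory.V3) = 0) → ∀ δ : ℝ, 0 < δ → ∃ T : ℝ, 0 < T ∧ ∃ R₀ : ℝ, 0 < R₀ ∧ ∀ R : ℝ, R₀ ≤ R → ∃ L₀ : ℝ, 0 < L₀ ∧ ∀ L : ℝ, L₀ ≤ L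 → ∀ n : ℕ, (n : ℝ) ≤ 2 * L ^ 3 → ∀ (Ψ : (k : ℕ) → Literature.Analysis.FluidPDE.HardSphereFlow (Literature.Analysis.FluidPDE.Euclidean.geometry (Fin 3)) σ k) (c : ℝ), |c| ≤ 1 → ∫⁻ z, ENNReal.ofReal (Real.exp (2 * c * ∑ i : Fin n, T⁻¹ * ∫ t in (0 : ℝ)..T, g (Literature.Analysis.FluidPDE.localClusterState Ψ R t z i).2)) ∂(Literature.Analysis.FluidPDE.particleLaw (Ψ n) (Literature.Analysis.FluidPDE.canonicalDensity (Literature.Analysis.FluidPDE.Euclidean.geometry (Fin 3)) σ n (fun p => Set.indicator {x : Literature.MathematicalPhysics.KineticTheory.V3 | ∀ k, x k ∈ Set.Icc (0 : ℝ) L} (fun _ => (1 : ℝ)) p.1 * Literature.Analysis.FluidPDE.globalMaxwellian p.2))) ≤ ENNReal.ofReal (Real.exp (δ * L ^ 3))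

/-- Statement of `stub_diniTransfer` — **DINI ACROSS DENSITY AND TILT** (sibling crux card
`dini-window-monotonicity`, decl `DiniTransfer : PointwiseCore → crux`; TRUE-grade, size L): window
subadditivity (`hΛ_h` subadditive under an invariant law — the route's ExponentialCertificate frame),
forecast-local ADD-ONE-PARTICLE Lipschitz continuity at fixed finite horizon (`localForecast_congr`:
deleting a particle changes the packing-bounded set of forecasts that see it and nothing else), and
Dini's theorem on the compact `[0,2] × [−1,1]` turn the pointwise statement into the uniform crux;
the `ρ → 0` end (lone particles never relax, Disproof §3–4) is absorbed by the static bound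
`≤ 2c²κ²ρ·vol` (needs `g ⊥ 1`), the gap `⌊ρL³⌋₊` vs arbitrary `n ≤ 2L³` by add-one once more. -/
def DiniTransfer : Prop := PointwiseCore → UniformCore

/-! ## 4. Registered stubs (the only `sorry`s of the line) -/

/-- STUB S4 (size M/L; TRUE-grade — it is route crux InfluenceLocality stmt-AtomisticToContinuum-13916
in the cell scaling, density `ρ ≤ 2` ↔ reduced diameter `σρ^{1/3}`; prove either and transport).
Sources: Alexander1976, MarchioroPellegrinottiPresutti1975, CagliotiMarchioroPulvirenti2000,
DobrushinFritz1977, Sinai1972, Spohn1991 Thm 1.2; triage r1-2 cross-cutting note (LD cone `R₀(T) ≳ T³`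
is harmless in this quantifier order). -/
theorem stub_influenceLocality : TorusInfluenceLocality := by
  sorry

/-- STUB S2a (size L; TRUE-grade: static boundary-layer comparison + Hölder + S4). Sources:
PulvirentiTsagkarogiannis2012, Scola2021, Ruelle1969 Thm 4.2.3 (low-density cluster expansion for the
comparison of canonical laws), the route's LocalCertificateTransfer step (6) (torus-cluster lift),
`HardSphereFlow.nonempty_torus_holds` (PROVED, `0 < ε < 1/2`), Disproof §1. -/
theorem stub_torusReduction : TorusInfluenceLocality → CellToTorusReduction := by
  sorry

/-- STUB S2b (size M; TRUE, provable now — Donsker–Varadhan + Fubini + joint convexity of KL +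
invariance of the torus canonical law). Sources: KipnisLandim1999 App. 1 §8 (entropy variational
formula), DemboZeitouni2010 §6.2 (Donsker–Varadhan), OllaVaradhanYau1993 §4 (A)–(E) (the K–B +
entropy prototype), Mathlib `InformationTheory.klDiv`, `MeasureTheory.Measure.tilted`,
`HardSphereFlow.measurePreserving`, `HardSphereFlow.aemeasurable_intervalIntegral_comp_flow_torus`;
route support HomogeneousInvariance (stmt-9621) is the `localGibbsLaw` twin of the invariance used. -/
theorem stub_entropyBallDuality : EntropyBallDuality := by
  sorry

/-- STUB S1 (size XL; OPEN — the HARDEST: the whole open content of the crux in time-free form; by the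
card's `CheapStateRefutes` a single cheap forecast-stationary state refutes 13915, 10967 and X at
once). Sources: OllaVaradhanYau1993 §4, GurevichSuhov1976, GenoveseSimonella2012 §1, Spohn1991 Part I
§2.4, NachtergaeleYau2003 §2.3, LiveraniOlla1996 Thm 1.2, FritzFunakiLebowitz1994,
BarangerMouhot2005 (PROVED gap `le_neg_maxwellianInner_hardSphereLinearizedOp_of_orthogonal_holds`),
Literature.Barriers.AtomisticToContinuum.BoltzmannHypothesisBarrierNarrow (caveat (b)),
MazurBoundBallisticNarrow (4)–(5). -/
theorem stub_oneBodyEntropicStiffness : OneBodyEntropicStiffness := by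
  sorry

/-- STUB S3 (size L; TRUE-grade GIVEN its two antecedents — local limits of blown-up torus states,
lower semicontinuity of specific relative entropy and equivalence of ensembles at low density,
continuity of the one-body bias, forecast-stationarity of K–B limits by the global entropy
inequality). Sources: GeorgiiZessin1993 §2.3 + Prop. 2.6, Georgii1994 Thm 1, Georgii1995,
Ruelle1969 Thm 4.2.3 / §7.2, OllaVaradhanYau1993 Lemma 4.1–4.2, Kifer1990,
`Literature.Probability.Entropy.KipnisLandim1999_A1_8_2` (entropy inequality, PROVED),
`Literature.Analysis.FluidPDE.localLaw` / `measurable_localConfig` (PROVED),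
`Literature.MathematicalPhysics.StatisticalMechanics.GeorgiiZessin1993_specificEntropy` (PROVED `_holds`). -/
theorem stub_kbClosure :
    TorusInfluenceLocality → OneBodyEntropicStiffness → KrylovBogoliubovClosure := by
  sorry

/-- STUB S5 (size L; TRUE-grade — sibling crux card `dini-window-monotonicity`; its first lemma
`AddOneParticleLipschitz` is forecast-local and deterministic). Sources: Mathlib
`Mathlib/Topology/UniformSpace/Dini.lean`, `ENNReal.lintegral_mul_le_Lp_mul_Lq`, tree
`localForecast_congr`, `localClusterState_congr`, `canonicalDensity_comp_perm`, Disproof §1/§3–4,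
PulvirentiTsagkarogiannis2012 (the `⌊ρL³⌋₊` pinning). -/
theorem stub_diniTransfer : TorusInfluenceLocality → DiniTransfer := by
  sorry

/-! ## 5. Composition (real proofs; no `sorry` below this line) -/

/-- `|fluxSum g c' n z| ≤ 2 |c'| n κ`. -/
theorem abs_fluxSum_le {g : V3 → ℝ} {κ : ℝ} (hgκ : ∀ v, |g v| ≤ κ) (c' : ℝ) (n : ℕ)
    (z : TorusPhase n) : |fluxSum g c' n z| ≤ 2 * |c'| * (n * κ) := by
  have hκ : 0 ≤ κ := (abs_nonneg _).trans (hgκ 0)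
  have hsum : |∑ i : Fin n, g ((z i).2)| ≤ n * κ := by
    calc |∑ i : Fin n, g ((z i).2)| ≤ ∑ i : Fin n, |g ((z i).2)| := Finset.abs_sum_le_sum_abs _ _
      _ ≤ ∑ _i : Fin n, κ := Finset.sum_le_sum fun i _ => hgκ _
      _ = n * κ := by simp
  unfold fluxSum
  rw [abs_mul, abs_mul, abs_two]
  exact mul_le_mul_of_nonneg_left hsum (by positivity)

/-- `fluxSum` is measurable (continuity of `g`; the torus phase space is a Borel space). -/
theorem measurable_fluxSum {g : V3 → ℝ} (hg : Continuous g) (c' : ℝ) (n : ℕ) :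
    Measurable (fluxSum g c' n) := by
  unfold fluxSum
  refine Measurable.const_mul ?_ _
  refine Finset.measurable_sum _ fun i _ => ?_
  exact hg.measurable.comp ((measurable_pi_apply i).snd)

/-- `⌊ρ L³⌋₊ ≤ 2 L³` for `0 ≤ ρ ≤ 2`, `0 ≤ L`. -/
theorem natFloor_le_two_mul {ρ L : ℝ} (hρ0 : 0 ≤ ρ) (hρ : ρ ≤ 2) (hL : 0 ≤ L) :
    ((⌊ρ * L ^ 3⌋₊ : ℕ) : ℝ) ≤ 2 * L ^ 3 := by
  have hL3 : 0 ≤ L ^ 3 := pow_nonneg hL 3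
  calc ((⌊ρ * L ^ 3⌋₊ : ℕ) : ℝ) ≤ ρ * L ^ 3 := Nat.floor_le (mul_nonneg hρ0 hL3)
    _ ≤ 2 * L ^ 3 := mul_le_mul_of_nonneg_right hρ hL3

/-- `(⌊ρ L³⌋₊ : ℝ) ≤ 2 Λ³` for `0 ≤ ρ ≤ 2`, `0 ≤ L ≤ Λ`. -/
theorem natFloor_le_two_mul_of_le {ρ L Λ : ℝ} (hρ0 : 0 ≤ ρ) (hρ : ρ ≤ 2) (hL : 0 ≤ L)
    (hLΛ : L ≤ Λ) : ((⌊ρ * L ^ 3⌋₊ : ℕ) : ℝ) ≤ 2 * Λ ^ 3 := by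
  have h1 := natFloor_le_two_mul hρ0 hρ hL
  have h2 : L ^ 3 ≤ Λ ^ 3 := pow_le_pow_left₀ hL hLΛ 3
  linarith

/-- **The pointwise core from the reduction, the duality and the closure** (quantifier bookkeeping +
two lines of arithmetic: `η = δ/17`, `C₀ = 16κ`, `T = T₀`, `ε = min(η/(16κ), 1)`; the torus has side
`Λ ∈ [L, 2L]`, so `log(cell functional) ≤ ηL³ + (|c'| − 1)·KL + ηΛ³ ≤ ηL³ + 2ηΛ³ ≤ 17ηL³ = δL³`). -/
theorem pointwiseCore_of_parts (hA : CellToTorusReduction) (hB : EntropyBallDuality)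
    (hC : KrylovBogoliubovClosure) : PointwiseCore := by
  obtain ⟨σA, hσA, HA⟩ := hA
  obtain ⟨σC, hσC, HC⟩ := hC
  refine ⟨min σA σC, lt_min hσA hσC, fun σ hσ hσlt => ?_⟩
  have hσA' : σ < σA := lt_of_lt_of_le hσlt (min_le_left _ _)
  have hσC' : σ < σC := lt_of_lt_of_le hσlt (min_le_right _ _)
  obtain ⟨κ, hκ, HCκ⟩ := HC σ hσ hσC'
  refine ⟨κ, hκ, fun g hg hgκ horth ρ hρ0 hρ2 c hc δ hδ => ?_⟩
  -- parameters
  set η : ℝ := δ / 17 with hηdef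
  have hη : 0 < η := by positivity
  set C₀ : ℝ := 16 * κ with hC₀def
  have hC₀ : 0 < C₀ := by positivity
  obtain ⟨T₀, hT₀, HT⟩ := HCκ g hg hgκ horth C₀ hC₀ η hη
  set ε : ℝ := min (η / (16 * κ)) 1 with hεdef
  have hε : 0 < ε := lt_min (by positivity) one_pos
  have hε1 : ε ≤ 1 := min_le_right _ _
  have hεη : ε * (16 * κ) ≤ η := by
    have : ε ≤ η / (16 * κ) := min_le_left _ _
    calc ε * (16 * κ) ≤ η / (16 * κ) * (16 * κ) := mul_le_mul_of_nonneg_right this (by positivity)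
      _ = η := div_mul_cancel₀ _ (by positivity)
  obtain ⟨R₀, hR₀, HR⟩ := HA σ hσ hσA' κ hκ g hg hgκ ρ hρ0 hρ2 c hc T₀ hT₀ η hη ε hε
  refine ⟨T₀, hT₀, R₀, hR₀, fun R hR => ?_⟩
  obtain ⟨La, hLa, HLa⟩ := HR R hR
  obtain ⟨Lc, hLc, HLc⟩ := HT T₀ le_rfl
  refine ⟨max (max La Lc) 1, lt_of_lt_of_le one_pos (le_max_right _ _), fun L hL Ψ => ?_⟩
  have hLa' : La ≤ L := (le_max_left _ _).trans ((le_max_left _ _).trans hL)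
  have hLc' : Lc ≤ L := (le_max_right _ _).trans ((le_max_left _ _).trans hL)
  have hL1 : 1 ≤ L := (le_max_right _ _).trans hL
  have hL0 : 0 < L := lt_of_lt_of_le one_pos hL1
  have hL3 : 0 ≤ L ^ 3 := pow_nonneg hL0.le 3
  -- step A: cell → torus of side Λ ∈ [L, 2L] (we keep `⌊ρ L³⌋₊` explicit: it occurs in types)
  obtain ⟨Λ, hLΛ, hΛ2L, Φ, c', hGprob, hc', hcell⟩ := HLa L hLa' Ψ
  have hΛ0 : 0 < Λ := lt_of_lt_of_le hL0 hLΛ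
  have hΛ3 : 0 ≤ Λ ^ 3 := pow_nonneg hΛ0.le 3
  have hΛ3le : Λ ^ 3 ≤ 8 * L ^ 3 := by
    calc Λ ^ 3 ≤ (2 * L) ^ 3 := pow_le_pow_left₀ hΛ0.le hΛ2L 3
      _ = 8 * L ^ 3 := by ring
  have hn : ((⌊ρ * L ^ 3⌋₊ : ℕ) : ℝ) ≤ 2 * Λ ^ 3 := natFloor_le_two_mul_of_le hρ0 hρ2 hL0.le hLΛ
  have hc'1 : |c'| ≤ 1 + ε := by
    calc |c'| ≤ (1 + ε) * |c| := hc'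
      _ ≤ (1 + ε) * 1 := mul_le_mul_of_nonneg_left hc (by positivity)
      _ = 1 + ε := mul_one _
  have hc'2 : |c'| ≤ 2 := by linarith
  -- step B: duality on the torus with f = fluxSum g c' n, C = 8 κ Λ³, τ = T₀ / Λ
  have hfb : ∀ z, |fluxSum g c' ⌊ρ * L ^ 3⌋₊ z| ≤ 8 * κ * Λ ^ 3 := by
    intro z
    calc |fluxSum g c' ⌊ρ * L ^ 3⌋₊ z| ≤ 2 * |c'| * ((⌊ρ * L ^ 3⌋₊ : ℕ) * κ) :=
          abs_fluxSum_le hgκ c' _ z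
      _ ≤ 2 * 2 * (2 * Λ ^ 3 * κ) := by
          apply mul_le_mul (mul_le_mul_of_nonneg_left hc'2 (by norm_num))
            (mul_le_mul_of_nonneg_right hn hκ.le) (by positivity) (by positivity)
      _ = 8 * κ * Λ ^ 3 := by ring
  have hτ : 0 < T₀ / Λ := div_pos hT₀ hΛ0
  have hσΛ : 0 < σ / Λ := div_pos hσ hΛ0
  obtain ⟨μ, hμP, hμac, hKL, hAI, hdual⟩ :=
    hB (σ / Λ) ⌊ρ * L ^ 3⌋₊ Φ hσΛ hGprob (fluxSum g c' ⌊ρ * L ^ 3⌋₊)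
      (measurable_fluxSum hg c' _) (8 * κ * Λ ^ 3) hfb (T₀ / Λ) hτ
  -- step C: the closure bounds the dual value
  have hKL' : InformationTheory.klDiv μ (torusGibbs (σ / Λ) ⌊ρ * L ^ 3⌋₊ Φ) ≤
      ENNReal.ofReal (C₀ * Λ ^ 3) := by
    refine hKL.trans (le_of_eq ?_)
    congr 1
    rw [hC₀def]; ring
  have hAI' : ∀ s : ℝ, 0 ≤ s → ∀ B : Set (TorusPhase ⌊ρ * L ^ 3⌋₊), MeasurableSet B →
      |(μ (Φ.flow s ⁻¹' B)).toReal - (μ B).toReal| ≤ 2 * s * Λ / T₀ := by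
    intro s hs B hB'
    have h := hAI s hs B hB'
    rwa [div_div_eq_mul_div] at h
  have hΛc : Lc ≤ Λ := hLc'.trans hLΛ
  have hclos := HLc Λ hΛc ⌊ρ * L ^ 3⌋₊ hn Φ μ hGprob hμP hμac hKL' hAI' c' hc'2
  -- arithmetic: ∫ f dμ − KL ≤ (|c'| − 1) KL + η Λ³ ≤ ε · 16 κ Λ³ + η Λ³ ≤ 2 η Λ³ ≤ 16 η L³
  have hKL0 : 0 ≤ (InformationTheory.klDiv μ (torusGibbs (σ / Λ) ⌊ρ * L ^ 3⌋₊ Φ)).toReal :=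
    ENNReal.toReal_nonneg
  have hKLle : (InformationTheory.klDiv μ (torusGibbs (σ / Λ) ⌊ρ * L ^ 3⌋₊ Φ)).toReal ≤
      16 * κ * Λ ^ 3 := by
    have h := ENNReal.toReal_mono ENNReal.ofReal_ne_top hKL
    rw [ENNReal.toReal_ofReal (by positivity)] at h
    calc (InformationTheory.klDiv μ (torusGibbs (σ / Λ) ⌊ρ * L ^ 3⌋₊ Φ)).toReal
        ≤ 2 * (8 * κ * Λ ^ 3) := h
      _ = 16 * κ * Λ ^ 3 := by ring
  have hexp : ∫ z, fluxSum g c' ⌊ρ * L ^ 3⌋₊ z ∂μ -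
      (InformationTheory.klDiv μ (torusGibbs (σ / Λ) ⌊ρ * L ^ 3⌋₊ Φ)).toReal ≤ 16 * η * L ^ 3 := by
    have h2 : (|c'| - 1) * (InformationTheory.klDiv μ (torusGibbs (σ / Λ) ⌊ρ * L ^ 3⌋₊ Φ)).toReal ≤
        ε * (16 * κ * Λ ^ 3) := by
      calc (|c'| - 1) * (InformationTheory.klDiv μ (torusGibbs (σ / Λ) ⌊ρ * L ^ 3⌋₊ Φ)).toReal
          ≤ ε * (InformationTheory.klDiv μ (torusGibbs (σ / Λ) ⌊ρ * L ^ 3⌋₊ Φ)).toReal :=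
            mul_le_mul_of_nonneg_right (by linarith) hKL0
        _ ≤ ε * (16 * κ * Λ ^ 3) := mul_le_mul_of_nonneg_left hKLle hε.le
    have h3 : ε * (16 * κ * Λ ^ 3) ≤ η * Λ ^ 3 := by
      calc ε * (16 * κ * Λ ^ 3) = ε * (16 * κ) * Λ ^ 3 := by ring
        _ ≤ η * Λ ^ 3 := mul_le_mul_of_nonneg_right hεη hΛ3
    have h4 : η * Λ ^ 3 ≤ 8 * η * L ^ 3 := by
      calc η * Λ ^ 3 ≤ η * (8 * L ^ 3) := mul_le_mul_of_nonneg_left hΛ3le hη.le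
        _ = 8 * η * L ^ 3 := by ring
    linarith [hclos, h2, h3, h4]
  have hI : torusExpMoment (σ / Λ) ⌊ρ * L ^ 3⌋₊ Φ (fluxSum g c' ⌊ρ * L ^ 3⌋₊) (T₀ / Λ) ≤
      ENNReal.ofReal (Real.exp (16 * η * L ^ 3)) :=
    hdual.trans (ENNReal.ofReal_le_ofReal (Real.exp_le_exp.2 hexp))
  have hone : (1 : ℝ≥0∞) ≤ ENNReal.ofReal (Real.exp (16 * η * L ^ 3)) := by
    rw [← ENNReal.ofReal_one]
    exact ENNReal.ofReal_le_ofReal (Real.one_le_exp (by positivity))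
  have hsup : (1 : ℝ≥0∞) ⊔ torusExpMoment (σ / Λ) ⌊ρ * L ^ 3⌋₊ Φ (fluxSum g c' ⌊ρ * L ^ 3⌋₊) (T₀ / Λ) ≤
      ENNReal.ofReal (Real.exp (16 * η * L ^ 3)) := sup_le hone hI
  -- assemble
  calc cellWindowPressure σ g c T₀ R L ⌊ρ * L ^ 3⌋₊ Ψ
      ≤ ENNReal.ofReal (Real.exp (η * L ^ 3)) *
          ((1 : ℝ≥0∞) ⊔ torusExpMoment (σ / Λ) ⌊ρ * L ^ 3⌋₊ Φ (fluxSum g c' ⌊ρ * L ^ 3⌋₊) (T₀ / Λ)) :=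
        hcell
    _ ≤ ENNReal.ofReal (Real.exp (η * L ^ 3)) * ENNReal.ofReal (Real.exp (16 * η * L ^ 3)) :=
        mul_le_mul' le_rfl hsup
    _ = ENNReal.ofReal (Real.exp (δ * L ^ 3)) := by
        rw [← ENNReal.ofReal_mul (Real.exp_pos _).le, ← Real.exp_add]
        congr 2
        rw [hηdef]; ring

/-- **The skeleton concludes the crux BY NAME.** `CellForecastPressureDecay` (route
`AntiMazurCoboundaries`, stmt-AtomisticToContinuum-13915) from the six registered stubs: influence
locality (S4) feeds the torus reduction (S2a) and the Krylov–Bogoliubov closure (S3), which with the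
exact entropy-ball duality (S2b) and one-body entropic stiffness (S1) give the pointwise core, and
the Dini transfer (S5) makes it uniform. -/
theorem CellForecastPressureDecay_of : CellForecastPressureDecay :=
  stub_diniTransfer stub_influenceLocality
    (pointwiseCore_of_parts (stub_torusReduction stub_influenceLocality) stub_entropyBallDuality
      (stub_kbClosure stub_influenceLocality stub_oneBodyEntropicStiffness))

end Summit.AtomisticToContinuum.HydrodynamicLimit.Cruxes.CellForecastPressureDecay.EntropyBallInvariantStates

end
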